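import Summits.AtomisticToContinuum.BoseEinsteinCondensation.Theorems.BECGroundStateSOSPeriodicIRBoundTwoSectorPairDefs2
import Summits.AtomisticToContinuum.BoseEinsteinCondensation.Theorems.BECGroundStateSOSPeriodicIRBoundTwoSectorSectorGaps
import Summits.AtomisticToContinuum.BoseEinsteinCondensation.Theorems.BECConjugateDominationPuffFloorRemovalEnergy
import HarnessLib

/-!
# Route `BECGroundStateSOS`, crux `PeriodicIRBound` (stmt-AtomisticToContinuum-3972), line `two-sector-gd-transfer` (v11) —
# stub S11d₂ₐ `stub_effectiveGapOf : EffectiveGapOf` (the effective gap at fixed `(N, L)`)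

Supports (does not close) stmt-AtomisticToContinuum-3972. The registered stub S11d₂ₐ of the v11 skeleton (statement
`EffectiveGapOf := ExchangeCondensateBound → PotCosLowerBound → FsumLowerBound → EffectiveGapAt` in
`Theorems/BECGroundStateSOSPeriodicIRBoundTwoSectorPairDefs2.lean`): at fixed `(N, L) = (m+2, L)` and one mode `n ≠ 0`
with `‖p‖R ≤ 1/4` (`p = 2πn/L`, `R` a range of `v`), for a condensate fraction `θ ≥ 0` and `η > 0`, every momentum-zero
near-minimiser `Ψ` with `n₀(Ψ) ≥ θN` obeys
`‖p‖² + (7θ/4 − 1)·N‖v‖₁/L³ − η ≤ 𝓔[aψ] + 𝓔[a†ψ] − E₀(2n_k+1) − (E₀(N) − E₀(N−1))`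
together with the variational bounds `E₀(N−1)·n_k ≤ 𝓔[aψ]`, `E₀(N+1)(n_k+1) ≤ 𝓔[a†ψ]`, `E₀(N) ≤ E₀(N+1)`.

Proof (per-state bookkeeping in `ℝ`; the three analytic inputs S11a, S11e, S11b are hypotheses). All `E₀(M, L)` are
finite for integrable `v` (`periodicGroundStateEnergy_ne_top_of_lintegral_ne_top`). Take the slack `min δ 1` with `δ`
from the f-sum bound S11b at `η`, so that a near-minimiser has finite energy form. Then: (1) S11b gives
`‖p‖² + N‖v‖₁/L³ + N·Re E − η ≤ qA + qC − e0(2n_k+1)`; (2) S11a at `Φ := ψ` (`‖ψ‖² = 1`) gives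
`v̂_L(p)n₀/L³ − ‖v‖₁(N − n₀)/L³ ≤ N·Re E`; (3) S11e and `‖p‖R ≤ 1/4` give `v̂_L(p) ≥ (3/4)‖v‖₁ ≥ 0`, whence with
`n₀ ≥ θN`: `N·Re E ≥ (7θ/4 − 1)N‖v‖₁/L³`; (4) Born's constant-mode insertion
(`PuffFloorRemovalEnergy.periodicGroundStateEnergy_succ_le`) read in `ℝ`: `e0 − e0m ≤ (N−1)‖v‖₁/L³`; (5) combine
(`EffectiveGap.real_core`, dropping `‖v‖₁/L³ ≥ 0`). (6) The variational conjuncts: `aψ`, `a†ψ` are core functions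
(`WF.isCore_modeAn/_modeCr`) of masses `n_k` and `1 + n_k` (`WF.normSq_modeAn/_modeCr`) and finite energy
(`WF.qform_modeAn_le/_modeCr_le`), so `E₀(m+1)·n_k ≤ 𝓔[aψ]` and `E₀(m+3)(n_k+1) ≤ 𝓔[a†ψ]`
(`WF.groundStateEnergy_mul_normSq_le`); `E₀(m+2) ≤ E₀(m+3)` is `WF.periodicGroundStateEnergy_le_succ`. No open
mathematics; references (shape only, nothing cited as a fact): T. Kennedy, E. H. Lieb, B. S. Shastry, J. Stat. Phys. 53
(1988) 1019, (12)–(14); `Cruxes/PeriodicIRBound/SOFT-LOCATION.md` Steps 2–4.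
-/

noncomputable section

open scoped BigOperators ENNReal ComplexConjugate
open Filter MeasureTheory

namespace Summit.AtomisticToContinuum.BoseEinsteinCondensation.Cruxes.PeriodicIRBound.TwoSectorGdTransfer

open Literature.MathematicalPhysics.QuantumManyBody.BoseGas
open Summit.AtomisticToContinuum.BoseEinsteinCondensation.Cruxes.PeriodicIRBound.LinearPhFloorWagner.WF
open Summit.AtomisticToContinuum.BoseEinsteinCondensation.Theorems.ZeroMomentumGround
  (periodicGroundStateEnergy_ne_top_of_lintegral_ne_top)
open Summit.AtomisticToContinuum.BoseEinsteinCondensation.Theorems (PuffFloorRemovalEnergy.periodicGroundStateEnergy_succ_le)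

namespace EffectiveGap

/-! ### The real-arithmetic core -/

/-- **Real-arithmetic core of the effective gap.** Reals: `P2 = ‖p‖²`, `a = m` (so `N = a + 2`), `w = ‖v‖₁ ≥ 0`,
`L3 = L³ > 0`, `E = Re E_ψ`, `pc = v̂_L(p)`, `n0 = n₀(ψ) ≥ θN`, `pR = ‖p‖R ≤ 1/4`; the f-sum bound `hF`, the exchange
bound `hX`, the cosine bound `hC` and Born's bound `hB` combine into the effective gap. -/
theorem real_core {P2 a w L3 E η Q e0 e0m pc n0 θ pR : ℝ} (hL3 : 0 < L3) (hw : 0 ≤ w) (hθ : 0 ≤ θ)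
    (ha : 0 ≤ a) (hpR : pR ≤ 1 / 4) (hC : w * (1 - pR) ≤ pc)
    (hX : pc * n0 / L3 - w * ((a + 2) - n0) / L3 ≤ (a + 2) * E)
    (hF : P2 + (a + 2) * w / L3 + (a + 2) * E - η ≤ Q)
    (hB : e0 - e0m ≤ (a + 1) * w / L3) (hn0 : θ * (a + 2) ≤ n0) :
    P2 + (7 * θ / 4 - 1) * ((a + 2) * w / L3) - η ≤ Q - (e0 - e0m) := by
  have hpc : 3 / 4 * w ≤ pc := by nlinarith [mul_nonneg hw (by linarith : (0 : ℝ) ≤ 1 / 4 - pR)]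
  have hn0' : 0 ≤ n0 := le_trans (mul_nonneg hθ (by linarith)) hn0
  have key : (7 * θ / 4 - 1) * ((a + 2) * w) ≤ pc * n0 - w * ((a + 2) - n0) := by
    nlinarith [mul_nonneg (sub_nonneg.2 hpc) hn0', mul_nonneg hw (sub_nonneg.2 hn0)]
  have hc : 0 ≤ L3⁻¹ := inv_nonneg.2 hL3.le
  have k2 := mul_le_mul_of_nonneg_right key hc
  have k3 := mul_nonneg hw hc
  simp only [div_eq_mul_inv] at hX hF hB ⊢
  nlinarith [k2, k3]

/-! ### Born's bound in `ℝ` (the small conversions `SectorGaps.qform_ne_top_of_nearMinAt`,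
`SectorGaps.cellOccupation_trialState_ne_top`, `PooledFloat.natCast_add_one_ne_top` are the landed ones) -/

/-- **Born's chemical-potential bound in `ℝ`**: `E₀(m+2) − E₀(m+1) ≤ (m+1)‖v‖₁/L³` for integrable measurable `v`
(`PuffFloorRemovalEnergy.periodicGroundStateEnergy_succ_le` read through `toReal`, all terms finite). -/
theorem born_toReal {v : ℝ → ℝ≥0∞} (hv : Measurable v) (hint : (∫⁻ x : Space, v ‖x‖) ≠ ⊤) (m : ℕ) {L : ℝ}
    (hL : 0 < L) :
    (periodicGroundStateEnergy v (m + 2) L).toReal - (periodicGroundStateEnergy v (m + 1) L).toReal ≤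
      ((m : ℝ) + 1) * wL1 v / L ^ 3 := by
  have hE : ∀ M, periodicGroundStateEnergy v M L ≠ ⊤ := fun M =>
    periodicGroundStateEnergy_ne_top_of_lintegral_ne_top hv hint M hL
  have hBE : periodicGroundStateEnergy v (m + 2) L ≤ periodicGroundStateEnergy v (m + 1) L +
      ((m + 1 : ℕ) : ℝ≥0∞) * (ENNReal.ofReal (L ^ 3))⁻¹ * ∫⁻ x : Space, v ‖x‖ :=
    PuffFloorRemovalEnergy.periodicGroundStateEnergy_succ_le hv (m + 1) hL
  have hL3 : 0 < L ^ 3 := by positivity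
  have hinv : (ENNReal.ofReal (L ^ 3))⁻¹ ≠ ⊤ := ENNReal.inv_ne_top.2 (ENNReal.ofReal_pos.2 hL3).ne'
  have hfin : ((m + 1 : ℕ) : ℝ≥0∞) * (ENNReal.ofReal (L ^ 3))⁻¹ * (∫⁻ x : Space, v ‖x‖) ≠ ⊤ :=
    ENNReal.mul_ne_top (ENNReal.mul_ne_top (ENNReal.natCast_ne_top _) hinv) hint
  have h := ENNReal.toReal_mono (ENNReal.add_ne_top.2 ⟨hE (m + 1), hfin⟩) hBE
  rw [ENNReal.toReal_add (hE (m + 1)) hfin, ENNReal.toReal_mul, ENNReal.toReal_mul, ENNReal.toReal_natCast,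
    ENNReal.toReal_inv, ENNReal.toReal_ofReal hL3.le] at h
  have hw : wL1 v = (∫⁻ x : Space, v ‖x‖).toReal := rfl
  rw [hw, div_eq_mul_inv]
  push_cast at h
  nlinarith [h]

end EffectiveGap

open EffectiveGap in
/-- **Stub S11d₂ₐ of the line `two-sector-gd-transfer` (v11)**: the effective gap at fixed `(N, L)` — the exchange bound
S11a, the cosine bound S11e and the two-sided f-sum S11b (hypotheses), Born's chemical-potential bound and the
variational bounds of the two test vectors `aψ`, `a†ψ` combine, at every momentum-zero near-minimiser with condensate
fraction `θ`, into `‖p‖² + (7θ/4 − 1)·N‖v‖₁/L³ − η ≤ 𝓔[aψ] + 𝓔[a†ψ] − E₀(2n_k+1) − (E₀(N) − E₀(N−1))`. -/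
theorem stub_effectiveGapOf : EffectiveGapOf := by
  intro h11a h11e h11b v hv hint R hR hvR m L hL n hn hpR θ η hθ hη
  have hE : ∀ M, periodicGroundStateEnergy v M L ≠ ⊤ := fun M =>
    periodicGroundStateEnergy_ne_top_of_lintegral_ne_top hv.1 hint M hL
  obtain ⟨δ, hδ, hfsum⟩ := h11b v hv hint m L hL (hE _) n hn η hη
  refine ⟨min δ 1, lt_min hδ one_pos, fun Ψ hΨ _h0 hn0 => ?_⟩
  have hΨδ : NearMinAt v δ Ψ := le_trans hΨ (add_le_add le_rfl (min_le_left _ _))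
  -- (1) the two-sided f-sum at `Ψ`
  have hF := hfsum Ψ hΨδ
  -- (2) the exchange bound at `Φ := ψ` (an `(m+1)+1`-body core)
  have hX : potCos v L (latticeVec (2 * Real.pi / L) n) *
        (cellOccupation (m + 2) L (planeWaveMode L 0) Ψ.ψ).toReal / L ^ 3 -
      wL1 v * ((((m + 1 : ℕ) : ℝ) + 1) * (normSq L Ψ.ψ).toReal -
        (cellOccupation (m + 2) L (planeWaveMode L 0) Ψ.ψ).toReal) / L ^ 3 ≤
      (((m + 1 : ℕ) : ℝ) + 1) * (exchCoef v L n Ψ.ψ).re :=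
    h11a v hv.1 hint (m + 1) L hL n Ψ.ψ (isCore_trialState Ψ)
  -- (3) the cosine bound
  have hC := h11e v hv.1 hint R hR hvR L hL n
  -- (4) Born
  have hB := born_toReal hv.1 hint m hL
  simp only at hF ⊢
  -- the state and its normalisation
  set ψ : Config (m + 2) → ℂ := Ψ.ψ with hψdef
  have hψc : IsCore L ψ := isCore_trialState Ψ
  have hψ1 : normSq L ψ = 1 := Ψ.norm_eq
  have hψEtop : qform v L ψ ≠ ⊤ := SectorGaps.qform_ne_top_of_nearMinAt (hE _) Ψ hΨ
  have hnψtop : normSq L ψ ≠ ⊤ := by rw [hψ1]; exact ENNReal.one_ne_top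
  rw [hψ1, ENNReal.toReal_one, mul_one] at hX
  push_cast at hX
  have h2 : (m : ℝ) + 1 + 1 = (m : ℝ) + 2 := by ring
  rw [h2] at hX
  -- (6) the variational conjuncts
  set νE : ℝ≥0∞ := cellOccupation (m + 2) L (planeWaveMode L n) ψ with hνE
  have hνtop : νE ≠ ⊤ := SectorGaps.cellOccupation_trialState_ne_top hL n Ψ
  -- hole test vector `aψ`
  set aΨ : Config (m + 1) → ℂ := modeAn L (planeWaveMode L n) ψ with haΨ
  have haΨc : IsCore L aΨ := isCore_modeAn hL n hψc
  have hmassA : normSq L aΨ = νE := normSq_modeAn hL n ψ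
  have haΨEtop : qform v L aΨ ≠ ⊤ :=
    ne_top_of_le_ne_top (ENNReal.mul_ne_top (PooledFloat.natCast_add_one_ne_top _) hψEtop)
      (qform_modeAn_le hL hv.1 n hψc)
  have hA1 : periodicGroundStateEnergy v (m + 1) L * νE ≤ qform v L aΨ := by
    rw [← hmassA]
    exact groundStateEnergy_mul_normSq_le hL hv.1 haΨc
  have hqA : (periodicGroundStateEnergy v (m + 1) L).toReal * νE.toReal ≤ (qform v L aΨ).toReal := by
    have h := ENNReal.toReal_mono haΨEtop hA1
    rwa [ENNReal.toReal_mul] at h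
  -- particle test vector `a†ψ`
  set cΨ : Config (m + 2 + 1) → ℂ := modeCr (planeWaveMode L n) ψ with hcΨ
  have hcΨc : IsCore L cΨ := isCore_modeCr hL n hψc
  have hmassC : normSq L cΨ = 1 + νE := by rw [hcΨ, normSq_modeCr hL n hψc, hψ1]
  have hcΨE := qform_modeCr_le hL hv.1 hint n hψc
  have hcΨEtop : qform v L cΨ ≠ ⊤ :=
    ne_top_of_le_ne_top (ENNReal.mul_ne_top (PooledFloat.natCast_add_one_ne_top _) (ENNReal.add_ne_top.2
      ⟨hψEtop, ENNReal.mul_ne_top ENNReal.ofReal_ne_top hnψtop⟩)) hcΨE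
  have hA2 : periodicGroundStateEnergy v (m + 2 + 1) L * (1 + νE) ≤ qform v L cΨ := by
    rw [← hmassC]
    exact groundStateEnergy_mul_normSq_le hL hv.1 hcΨc
  have hqC : (periodicGroundStateEnergy v (m + 2 + 1) L).toReal * (νE.toReal + 1) ≤ (qform v L cΨ).toReal := by
    have h := ENNReal.toReal_mono hcΨEtop hA2
    rw [ENNReal.toReal_mul, ENNReal.toReal_add ENNReal.one_ne_top hνtop, ENNReal.toReal_one] at h
    linarith
  have he0p : (periodicGroundStateEnergy v (m + 2) L).toReal ≤ (periodicGroundStateEnergy v (m + 2 + 1) L).toReal :=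
    ENNReal.toReal_mono (hE _) (periodicGroundStateEnergy_le_succ hL hv.1 (m + 2))
  refine ⟨?_, hqA, hqC, he0p⟩
  -- (5) combine
  exact real_core (by positivity) ENNReal.toReal_nonneg hθ m.cast_nonneg hpR hC hX hF hB hn0

end Summit.AtomisticToContinuum.BoseEinsteinCondensation.Cruxes.PeriodicIRBound.TwoSectorGdTransfer

end
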